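import Mathlib
import Summits.QuantumFields.YangMills.Theses.CoarseStiffnessTail
import Summits.QuantumFields.YangMills.Theorems.CoarseStiffnessTailCappedCoarseStiffnessLUnitPolyTailOfCount
import Summits.QuantumFields.YangMills.Theorems.CoarseStiffnessTailCappedCoarseStiffnessLBareUniformCount

/-!
# Route `CoarseStiffnessTail` (rev 1 «unit-poly-tail») — crux `UnitPolyTailL` (stmt-QuantumFields-24027): THE FIRST RUNG `K = 0`
# (BC5 witness of LINE 20): the power-law unit-scale single-plaquette tail HOLDS at the bare cut-off, for EVERY profile, unconditionally

Prover seat `ym-line-cst-p1` (g23).  The deciding crux S1_poly = `UnitPolyTailL` asks, for every block size `L` and thresholds `(b₁, p₁)`, a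
profile `(b₀, p₀)` beyond them, `s > 3`, `C ≥ 0`, `γ₁ ∈ (0, 1]` with
`Gibbs_K{θBal(L, γ, b₀, p₀, 0) ≤ |Ū^K(∂a) − 1|} ≤ C·γ^s` for every family `F` (`F.L = L`), every `0 < γ ≤ γ₁`, EVERY cut-off `K` and every unit
plaquette `a` (`Ū^K` = the `K`-fold block-averaged field).  Its content is the uniformity in `K`.  This file proves the `K = 0` SLICE — no
averaging: `Gibbs_0` is the bare Wilson law at `β = γ⁻¹` on the unit torus `(2L^m)³` and `Ū^0 = U` — for EVERY profile `0 < b₀`, `2 ≤ p₀`, with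
`s = 4` and the explicit constant `C = exp(9000·L³·log 2)`, uniformly in the volume exponent `m`:

* §1 `polyTail_K0_at` — per profile: `Gibbs_0{θ_γ(0) ≤ |U(∂a) − 1|} ≤ e^{9000L³ log 2}·γ⁴` for `γ ≤ γ₁(b₀, p₀)`.  Proof = the `K = 0` branch of
  g22's `CoarseStiffnessTailUnitPolyTailOfChi.unitPolyTail_of_intCoreRecRows`, made standalone: the landed bare uniform large-field COUNT bound
  `bare_uniformLargeFieldCount_clean` (`∫ exp((1/24)·p(√γ)²·N_0) dGibbs_0 ≤ 2^{#Plaq}`, reflection positivity + the single-plaquette Wilson tail,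
  [FrohlichIsraelLiebSimon1978] Thm 4.1), the top-slice chessboard `perPlaquetteTop_of_countTop` (per-plaquette tail `≤ e^{9000L³|log 2|}·e^{−p(√γ)²/24}`)
  and «the Gaussian factor is below every power of the coupling» `exp_neg_pFun_sq_le_pow` (`e^{−p(√γ)²/24} ≤ γ⁴` for `γ ≤ γ₀`).
* §2 `unitPolyTailL_rung_K0` — the text of `UnitPolyTailL` with the cut-off specialised to `K = 0` (profile `b₀ = max b₁ 1`, `p₀ = max p₁ 3`), and
  `rung_K0_of_unitPolyTailL` recording that it IS the `K = 0` instance of the crux.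

WHY IT IS A WITNESS AND NOT THE CRUX.  At `K = 0` there is no renormalisation group: the estimate is reflection positivity of the Wilson action plus
one-plaquette calculus, and it holds for every profile with a UNIFORM rate `1/24` — exactly the regime where the rev-0 crux `CappedCoarseStiffnessL`
also holds (`bare_uniformLargeFieldCount`).  The crux is the same bound after `K ≥ 1` block-averaging steps from spacing `L^{-K}`, uniformly in `K`
([Balaban1985UV3] (71) p.273 bounds the corresponding DENSITY inside the inductive representation); nothing of that is proved here.

HONEST FRAMING.  Unconditional but elementary; `UnitPolyTailL`, `HistoryTailL` (stmt-QuantumFields-19936) and the rung `YM3TorusSU2` (R3, a RECORD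
rung — existence/uniqueness of Bałaban's UV limit on the 3-torus — NOT the Clay statement) stay OPEN; the Yang–Mills mass gap is not touched.

References: [Balaban1985UV3] T. Bałaban, Commun. Math. Phys. **102** (1985) 255–275 ((7) p.257, (71) p.273); [FrohlichIsraelLiebSimon1978] J. Fröhlich,
R. Israel, E. H. Lieb, B. Simon, Commun. Math. Phys. **62** (1978) 1–34 (Thm 4.1).
-/

set_option autoImplicit false

noncomputable section

namespace Summit.QuantumFields.YangMills.Theorems.CoarseStiffnessTailUnitPolyTailLRungK0

open MeasureTheory
open Literature.MathematicalPhysics.QuantumFieldTheory.Balaban1983to89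
open Literature.MathematicalPhysics.QuantumFieldTheory.Balaban1983to89.T3ContinuumYM3Torus
open Literature.MathematicalPhysics.QuantumFieldTheory.Balaban1983to89.T3UnitScaleTilt
open Literature.MathematicalPhysics.QuantumFieldTheory.Balaban1983to89.T3UnitLawDensityEML
open Summit.QuantumFields.YangMills.Theses.CoarseStiffnessTail (UnitPolyTailL)
open Summit.QuantumFields.YangMills.Theorems.CoarseStiffnessTailBareUniformCount (bare_uniformLargeFieldCount_clean)
open Summit.QuantumFields.YangMills.Theorems.CoarseStiffnessTailUnitPolyTailOfCount (perPlaquetteTop_of_countTop exp_neg_pFun_sq_le_pow)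

/-! ## §1 The bare cut-off, every profile -/

/-- ★ **THE UNIT-SCALE POWER TAIL AT THE BARE CUT-OFF `K = 0`, EVERY PROFILE**: for `0 < b₀`, `2 ≤ p₀` there is `γ₁ ∈ (0, 1]` such that for every
three-torus family `F`, every `0 < γ ≤ γ₁` and every plaquette `a` of the unit torus, the bare Wilson–Gibbs law (`β = γ⁻¹`, no averaging) gives
`Gibbs_0{θBal(L, γ, b₀, p₀, 0) ≤ |U(∂a) − 1|} ≤ exp(9000·L³·|log 2|)·γ⁴`.  Bare uniform count bound (RP, [FrohlichIsraelLiebSimon1978] Thm 4.1) + top-slice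
chessboard + `e^{−p(√γ)²/24} ≤ γ⁴`.  Elementary; no renormalisation step is involved. [cite: FrohlichIsraelLiebSimon1978, Thm 4.1; Balaban1985UV3, (7) p.257] -/
theorem polyTail_K0_at {b₀ p₀ : ℝ} (hb₀ : 0 < b₀) (hp₀ : 2 ≤ p₀) :
    ∃ γ₁ : ℝ, 0 < γ₁ ∧ γ₁ ≤ 1 ∧ ∀ (F : T3Family) (γ : ℝ), 0 < γ → γ ≤ γ₁ → ∀ (a : Plaq (F.P 0) 0),
      (gibbsK F ℰp γ 0).real
          {U | θBal F.L γ b₀ p₀ 0 ≤ GaugeGroup.dist1 (GaugeField.plaqHol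
            (Averaging.iter (fun i => BlockAveraging.blockAvg (P := F.P 0) (j := i) ℰp) 0 U) a)} ≤
        Real.exp (9000 * (F.L : ℝ) ^ 3 * |Real.log 2|) * γ ^ (4 : ℕ) := by
  obtain ⟨γb, hγb, hγb1, hbare⟩ := bare_uniformLargeFieldCount_clean (p₀ := p₀) hb₀ (by linarith)
  obtain ⟨γ₀, hγ₀, -, hexp⟩ := exp_neg_pFun_sq_le_pow hb₀ hp₀ (by norm_num : (0 : ℝ) < 1 / 24) 4
  refine ⟨min γb γ₀, lt_min hγb hγ₀, (min_le_left _ _).trans hγb1, fun F γ hγ hγle a => ?_⟩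
  have hγγb : γ ≤ γb := hγle.trans (min_le_left _ _)
  have hγγ₀ : γ ≤ γ₀ := hγle.trans (min_le_right _ _)
  have hγ1 : γ ≤ 1 := hγγb.trans hγb1
  have hN := hbare F γ hγ hγγb 0
  rw [pow_zero, mul_one] at hN
  have htop := perPlaquetteTop_of_countTop F hγ hγ1 (θ := θBal F.L γ b₀ p₀ 0)
    (t := (1 / 24) * B10.pFun b₀ p₀ (Real.sqrt γ) ^ 2) (C₁ := Real.log 2) (by positivity) 0 hN a
  refine htop.trans ?_
  exact mul_le_mul_of_nonneg_left (hexp γ hγ hγγ₀) (Real.exp_pos _).le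

/-! ## §2 The rung in the crux's own format -/

/-- ★ **BC5 RUNG OF LINE 20: `UnitPolyTailL` AT THE BARE CUT-OFF `K = 0`** — the text of the deciding crux S1_poly =
`CoarseStiffnessTail.UnitPolyTailL` (stmt-QuantumFields-24027) with the cut-off specialised to `K = 0`, PROVED unconditionally: for every `L`,
`(b₁, p₁)` the profile `b₀ = max b₁ 1`, `p₀ = max p₁ 3`, `s = 4`, `C = exp(9000·L³·|log 2|)` and `γ₁(b₀, p₀)` of §1 work.  A witness of weakness,
not progress on the crux: the crux's content is uniformity in `K ≥ 1`. [cite: FrohlichIsraelLiebSimon1978, Thm 4.1; Balaban1985UV3, (71) p.273] -/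
theorem unitPolyTailL_rung_K0 :
    ∀ (L : ℕ) (b₁ p₁ : ℝ), ∃ (b₀ p₀ : ℝ), b₁ ≤ b₀ ∧ p₁ ≤ p₀ ∧ 0 < b₀ ∧ 2 < p₀ ∧
      ∃ (s C γ₁ : ℝ), 3 < s ∧ 0 ≤ C ∧ 0 < γ₁ ∧ γ₁ ≤ 1 ∧
        ∀ (F : T3Family) (γ : ℝ), F.L = L → 0 < γ → γ ≤ γ₁ → ∀ (a : Plaq (F.P 0) 0),
          (gibbsK F ℰp γ 0).real
              {U | θBal F.L γ b₀ p₀ 0 ≤ GaugeGroup.dist1 (GaugeField.plaqHol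
                (Averaging.iter (fun i => BlockAveraging.blockAvg (P := F.P 0) (j := i) ℰp) 0 U) a)} ≤
            C * γ ^ s := by
  intro L b₁ p₁
  have hb₀ : 0 < max b₁ 1 := lt_of_lt_of_le one_pos (le_max_right _ _)
  have hp₀ : (2 : ℝ) < max p₁ 3 := lt_of_lt_of_le (by norm_num) (le_max_right _ _)
  obtain ⟨γ₁, hγ₁, hγ₁1, hT⟩ := polyTail_K0_at hb₀ hp₀.le
  refine ⟨max b₁ 1, max p₁ 3, le_max_left _ _, le_max_left _ _, hb₀, hp₀, ((4 : ℕ) : ℝ),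
    Real.exp (9000 * (L : ℝ) ^ 3 * |Real.log 2|), γ₁, by norm_num, (Real.exp_pos _).le, hγ₁, hγ₁1,
    fun F γ hFL hγ hγle a => ?_⟩
  rw [Real.rpow_natCast]
  subst hFL
  exact hT F γ hγ hγle a

/-- The rung IS the `K = 0` instance of the crux: `UnitPolyTailL` implies `unitPolyTailL_rung_K0`'s statement by instantiation (recorded so that
the witness is visibly a special case of stmt-QuantumFields-24027 and nothing more). -/
theorem rung_K0_of_unitPolyTailL (h : UnitPolyTailL) :
    ∀ (L : ℕ) (b₁ p₁ : ℝ), ∃ (b₀ p₀ : ℝ), b₁ ≤ b₀ ∧ p₁ ≤ p₀ ∧ 0 < b₀ ∧ 2 < p₀ ∧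
      ∃ (s C γ₁ : ℝ), 3 < s ∧ 0 ≤ C ∧ 0 < γ₁ ∧ γ₁ ≤ 1 ∧
        ∀ (F : T3Family) (γ : ℝ), F.L = L → 0 < γ → γ ≤ γ₁ → ∀ (a : Plaq (F.P 0) 0),
          (gibbsK F ℰp γ 0).real
              {U | θBal F.L γ b₀ p₀ 0 ≤ GaugeGroup.dist1 (GaugeField.plaqHol
                (Averaging.iter (fun i => BlockAveraging.blockAvg (P := F.P 0) (j := i) ℰp) 0 U) a)} ≤
            C * γ ^ s := by
  intro L b₁ p₁
  obtain ⟨b₀, p₀, hb₁, hp₁, hb₀, hp₀, s, C, γ₁, hs, hC, hγ₁, hγ₁1, hT⟩ := h L b₁ p₁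
  exact ⟨b₀, p₀, hb₁, hp₁, hb₀, hp₀, s, C, γ₁, hs, hC, hγ₁, hγ₁1, fun F γ hFL hγ hγle a => hT F γ hFL hγ hγle 0 a⟩

end Summit.QuantumFields.YangMills.Theorems.CoarseStiffnessTailUnitPolyTailLRungK0

end
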